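import Literature.Topology.FourManifolds.TrisectionCentralSurfaceMarking
import Summits.SmoothPoincare4.SmoothPoincare4.Theorems.CongruenceShadowsAgkCor6SufficiencyStubHandlebodyExtension
import Summits.SmoothPoincare4.SmoothPoincare4.Theorems.CongruenceShadowsAgkCor6SufficiencyStubSeamDiffeosCollar
import Summits.SmoothPoincare4.SmoothPoincare4.Theorems.CongruenceShadowsAgkCor6SufficiencyStubSeamDiffeosBoundary
import Summits.SmoothPoincare4.SmoothPoincare4.Theorems.CongruenceShadowsAgkCor6SufficiencyStubSeamDiffeosExtend

/-!
# Stub `stub_seamDiffeos` of line `lp-by-sphere-system-surgery` for crux `AgkCor6Sufficiency`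
(item stmt-SmoothPoincare4-10894, routes CongruenceShadows / GroupTrisection; lead reshape r5, B2)

**The three seam diffeomorphisms of Abrams–Gay–Kirby's proof of Thm. 5** ("the spine
`H₀ ∪ H₁ ∪ H₂` determines a neighbourhood"), `Ξ`-standard near the central surface
(`SeamDiffeosStmt`, the line's statement B2, declared here verbatim from the skeleton), proved from
`ProductLikeNormalisation` (uniqueness of collars, B1) and `HandlebodyExtension` (Griffiths):
for each seam `H_m = S (m+1) ∩ S (m+2)` of two balanced Gay–Kirby trisections in tri-normal form
with tube structures,

1. the clause-(iii) handlebodies `hd : H ↪ X`, `hd' : H' ↪ X'` (`IsGKTrisection.exists_isHandlebody`,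
   orientable), boundary data `∂H`, `∂H'` (`BoundaryManifold.boundaryData`);
2. the boundary diffeomorphism `φ : ∂H ≅ ∂H'` induced by the ambient extensions `Ψa`, `Ψa'` of
   `ψ^{±1}` (`exists_boundaryDiffeo`) and its kernel condition at the point over `x₀`
   (`seam_kernel_condition`, from the kernel condition of `ψ`);
3. `HandlebodyExtension`: a diffeomorphism `Φ₀ : H ≅ H'` extending `φ`;
4. the `Ξ`-collars `D`, `D'` of the seams (`exists_xiCollar`, common scale `sc = min rt rt' / 4`)
   and `ProductLikeNormalisation`: `Φ : H ≅ H'` extending `φ` with `Φ (D x t) = D' (φ x) t`,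
   `t ≤ ε`; hence the product formula `hd' ∘ Φ = tp' (Ψa ∘ ρ, u, v) ∘ hd` in the tube
   `T(sc · min ε 1)` (`product_formula`), and symmetrically for `Φ⁻¹`;
5. ambient smooth maps `Ψs ⊇ hd' ∘ Φ ∘ hd⁻¹`, `Ψs' ⊇ hd ∘ Φ⁻¹ ∘ hd'⁻¹` of open neighbourhoods of
   the seams (`exists_seam_extension`: the product map near `F`, slice charts at interior points,
   glued by a partition of unity after a Whitney embedding);
6. `rP := min_m (sc · min ε_m 1)`.

References: Abrams–Gay–Kirby, *Group trisections and smooth 4-manifolds*, Geom. Topol. 22 (2018),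
proof of Thm. 5 [AbramsGayKirby2018]; Gay–Kirby, Geom. Topol. 20 (2016), Def. 1 [GayKirby2016];
Hirsch, *Differential Topology* (1976), Ch. 8 §1 [HirschDT1976]; Milnor, *Topology from the
differentiable viewpoint* (1965), §1.
-/

noncomputable section

-- the prescribed namespace `Summit.<P>.<Sub>.…` duplicates `SmoothPoincare4` (P = Sub)
set_option linter.dupNamespace false

namespace Summit.SmoothPoincare4.SmoothPoincare4.Cruxes.AgkCor6Sufficiency.LpBySphereSystemSurgery

open Set Function Filter
open scoped _root_.Manifold _root_.ContDiff _root_.Topology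
open Literature.Topology.FourManifolds

/-! ## The statement (verbatim from the skeleton) -/

/-- **B2 — the seam diffeomorphisms** (from `ProductLikeNormalisation` and
`HandlebodyExtension`): the clause-(iii) handlebodies of the two trisections
(`IsGKTrisection.exists_isHandlebody`, orientable), their `Ξ`-collars (open collar data built
from `tp`), the boundary diffeomorphism induced by `ψ` (ambient smoothness) with its kernel
condition, `HandlebodyExtension`, and the product-like normalisation. -/
def SeamDiffeosStmt : Prop :=
  ∀ (X : Type) [TopologicalSpace X] [T2Space X] [SecondCountableTopology X]
    [ChartedSpace (EuclideanSpace ℝ (Fin 4)) X] [IsManifold (𝓡 4) ∞ X] [CompactSpace X]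
    [ConnectedSpace X] (_ : SmoothOrientation (𝓡 4) X)
    (X' : Type) [TopologicalSpace X'] [T2Space X'] [SecondCountableTopology X']
    [ChartedSpace (EuclideanSpace ℝ (Fin 4)) X'] [IsManifold (𝓡 4) ∞ X'] [CompactSpace X']
    [ConnectedSpace X'] (_ : SmoothOrientation (𝓡 4) X')
    (g k : ℕ) (S : Fin 3 → Set X) (S' : Fin 3 → Set X')
    (_ : IsBalancedGKTrisection X g k S) (_ : IsBalancedGKTrisection X' g k S')
    (x₀ : centralSurface S) (x₀' : centralSurface S')
    (ψ : centralSurface S ≃ₜ centralSurface S') (hψ : ψ x₀ = x₀'),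
    (∀ i : Fin 3, ((FundamentalGroup.map (centralInclusion S i) x₀).ker).map
        (FundamentalGroup.mapOfEq (⟨ψ, ψ.continuous⟩ : C(centralSurface S, centralSurface S')) hψ)
        = (FundamentalGroup.map (centralInclusion S' i) x₀').ker) →
    ∀ (u v : X → ℝ) (ρ : X → X) (U O Ot : Set X) (rt : ℝ) (tp : X → ℝ → ℝ → X)
      (u' v' : X' → ℝ) (ρ' : X' → X') (U' O' Ot' : Set X') (rt' : ℝ) (tp' : X' → ℝ → ℝ → X'),
    TriNormalForm S 0 1 2 u v ρ U O (fun _ => handleCount 1 k) →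
    TriNormalForm S' 0 1 2 u' v' ρ' U' O' (fun _ => handleCount 1 k) →
    TubeStructure (S 0) (⋂ l, S l) u v ρ O Ot rt tp →
    TubeStructure (S' 0) (⋂ l, S' l) u' v' ρ' O' Ot' rt' tp' →
    ∀ (Uψ : Set X) (Ψa : X → X') (Uψ' : Set X') (Ψa' : X' → X),
    IsOpen Uψ → (⋂ l, S l) ⊆ Uψ → ContMDiffOn (𝓡 4) (𝓡 4) ∞ Ψa Uψ →
    (∀ x : centralSurface S, Ψa x = (ψ x : X')) →
    IsOpen Uψ' → (⋂ l, S' l) ⊆ Uψ' → ContMDiffOn (𝓡 4) (𝓡 4) ∞ Ψa' Uψ' →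
    (∀ x : centralSurface S', Ψa' x = (ψ.symm x : X)) →
    ∃ rP : ℝ, SeamDiffeos S S' u v ρ Ot tp u' v' ρ' Ot' tp' Ψa Ψa' rP

/-! ## One seam -/

namespace B2

section Piece

variable {X : Type} [TopologicalSpace X] [T2Space X] [SecondCountableTopology X]
  [ChartedSpace (EuclideanSpace ℝ (Fin 4)) X] [IsManifold (𝓡 4) ∞ X] [CompactSpace X]
  {X' : Type} [TopologicalSpace X'] [T2Space X'] [SecondCountableTopology X']
  [ChartedSpace (EuclideanSpace ℝ (Fin 4)) X'] [IsManifold (𝓡 4) ∞ X'] [CompactSpace X']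
  {g k : ℕ} {S : Fin 3 → Set X} {S' : Fin 3 → Set X'}
  {u v : X → ℝ} {ρ : X → X} {U O Ot : Set X} {rt : ℝ} {tp : X → ℝ → ℝ → X}
  {u' v' : X' → ℝ} {ρ' : X' → X'} {U' O' Ot' : Set X'} {rt' : ℝ} {tp' : X' → ℝ → ℝ → X'}
  {c c' : Fin 3 → ℕ → ℕ}
  {Uψ : Set X} {Ψa : X → X'} {Uψ' : Set X'} {Ψa' : X' → X}

omit [T2Space X] [SecondCountableTopology X] [IsManifold (𝓡 4) ∞ X] [CompactSpace X]
  [T2Space X'] [SecondCountableTopology X'] [IsManifold (𝓡 4) ∞ X'] [CompactSpace X'] in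
/-- The tube `T(r)` of a tube structure is open. -/
theorem isOpen_tubeSet (hfr : NormalFrame (⋂ l, S l) u v ρ U O)
    (hTS : TubeStructure (S 0) (⋂ l, S l) u v ρ O Ot rt tp) (r : ℝ) : IsOpen (tubeSet Ot u v r) :=
  hTS.isOpen.inter (isOpen_lt ((hfr.contMDiff_u.continuous.pow 2).add
    (hfr.contMDiff_v.continuous.pow 2)) continuous_const)

omit [T2Space X] [SecondCountableTopology X] [IsManifold (𝓡 4) ∞ X] [CompactSpace X]
  [T2Space X'] [SecondCountableTopology X'] [IsManifold (𝓡 4) ∞ X'] [CompactSpace X'] in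
/-- **The product map `x ↦ tp' (Ψa (ρ x)) (u x) (v x)` is smooth on the tube `T(rP)`**,
`rP ≤ rt'` (`Ψa` smooth on `Uψ ⊇ F` mapping `F` into `F'`; `TubeStructure.contMDiffOn_tp`). -/
theorem contMDiffOn_productMap (hT : TriNormalForm S 0 1 2 u v ρ U O c)
    (hTS : TubeStructure (S 0) (⋂ l, S l) u v ρ O Ot rt tp)
    (hTS' : TubeStructure (S' 0) (⋂ l, S' l) u' v' ρ' O' Ot' rt' tp')
    (hFU : (⋂ l, S l) ⊆ Uψ) (hΨa : ContMDiffOn (𝓡 4) (𝓡 4) ∞ Ψa Uψ)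
    (hΨaF : MapsTo Ψa (⋂ l, S l) (⋂ l, S' l)) {rP : ℝ} (hrP : 0 ≤ rP) (hrPt' : rP ≤ rt') :
    ContMDiffOn (𝓡 4) (𝓡 4) ∞ (fun x => tp' (Ψa (ρ x)) (u x) (v x)) (tubeSet Ot u v rP) := by
  have hρF : ∀ x ∈ tubeSet Ot u v rP, ρ x ∈ ⋂ l, S l := fun x hx =>
    hT.frame.ρ_mem _ (hTS.subset_O hx.1)
  refine hTS'.contMDiffOn_tp ?_ hT.frame.contMDiff_u.contMDiffOn hT.frame.contMDiff_v.contMDiffOn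
    (fun x hx => hΨaF (hρF x hx)) (fun x hx => lt_of_lt_of_le hx.2 (pow_le_pow_left₀ hrP hrPt' 2))
  exact hΨa.comp hT.frame.contMDiff_ρ.contMDiffOn fun x hx => hFU (hρF x hx)

/-- **One seam diffeomorphism** (steps 1–6 of the module docstring for a fixed seam `m`): a
radius `r > 0` such that for every `0 < rP ≤ r` the maps `Ψs`, `Ψs'` of the clause of
`SeamDiffeos` at `m` exist. -/
theorem seam_piece (hPL : ProductLikeNormalisation) (hHE : HandlebodyExtension)
    (o : SmoothOrientation (𝓡 4) X) (o' : SmoothOrientation (𝓡 4) X')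
    (h : IsBalancedGKTrisection X g k S) (h' : IsBalancedGKTrisection X' g k S')
    (x₀ : centralSurface S) {x₀' : centralSurface S'}
    (ψ : centralSurface S ≃ₜ centralSurface S') (hψ : ψ x₀ = x₀') (m : Fin 3)
    (hker : ((FundamentalGroup.map (centralInclusion S m) x₀).ker).map
        (FundamentalGroup.mapOfEq (⟨ψ, ψ.continuous⟩ : C(centralSurface S, centralSurface S')) hψ)
        = (FundamentalGroup.map (centralInclusion S' m) x₀').ker)
    (hT : TriNormalForm S 0 1 2 u v ρ U O c) (hT' : TriNormalForm S' 0 1 2 u' v' ρ' U' O' c')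
    (hTS : TubeStructure (S 0) (⋂ l, S l) u v ρ O Ot rt tp)
    (hTS' : TubeStructure (S' 0) (⋂ l, S' l) u' v' ρ' O' Ot' rt' tp')
    (hFU : (⋂ l, S l) ⊆ Uψ) (hΨa : ContMDiffOn (𝓡 4) (𝓡 4) ∞ Ψa Uψ)
    (hΨaψ : ∀ x : centralSurface S, Ψa x = (ψ x : X'))
    (hFU' : (⋂ l, S' l) ⊆ Uψ') (hΨa' : ContMDiffOn (𝓡 4) (𝓡 4) ∞ Ψa' Uψ')
    (hΨaψ' : ∀ x : centralSurface S', Ψa' x = (ψ.symm x : X)) :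
    ∃ r : ℝ, 0 < r ∧ ∀ rP : ℝ, 0 < rP → rP ≤ r →
      ∃ (W : Set X) (Ψs : X → X') (W' : Set X') (Ψs' : X' → X),
      IsOpen W ∧ S (m + 1) ∩ S (m + 2) ⊆ W ∧ ContMDiffOn (𝓡 4) (𝓡 4) ∞ Ψs W ∧
      IsOpen W' ∧ S' (m + 1) ∩ S' (m + 2) ⊆ W' ∧ ContMDiffOn (𝓡 4) (𝓡 4) ∞ Ψs' W' ∧
      MapsTo Ψs (S (m + 1) ∩ S (m + 2)) (S' (m + 1) ∩ S' (m + 2)) ∧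
      MapsTo Ψs' (S' (m + 1) ∩ S' (m + 2)) (S (m + 1) ∩ S (m + 2)) ∧
      (∀ x ∈ S (m + 1) ∩ S (m + 2), Ψs' (Ψs x) = x) ∧
      (∀ x' ∈ S' (m + 1) ∩ S' (m + 2), Ψs (Ψs' x') = x') ∧
      (∀ x ∈ S (m + 1) ∩ S (m + 2), x ∈ tubeSet Ot u v rP →
        Ψs x = tp' (Ψa (ρ x)) (u x) (v x)) ∧
      (∀ x' ∈ S' (m + 1) ∩ S' (m + 2), x' ∈ tubeSet Ot' u' v' rP →
        Ψs' x' = tp (Ψa' (ρ' x')) (u' x') (v' x')) := by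
  -- ### 1. the handlebodies and their boundary data
  have hne : (m + 1 : Fin 3) ≠ m + 2 := fun hm => absurd (add_left_cancel hm) (by decide)
  obtain ⟨H, _, _, hM, hd, hH, hhd, hrange, hbd⟩ := h.isGKTrisection.exists_isHandlebody ⟨o⟩ hne
  haveI := hM
  haveI := hH.compactSpace
  haveI := hH.connectedSpace
  haveI : T2Space H := hhd.isEmbedding.t2Space
  haveI : SecondCountableTopology H := hhd.isEmbedding.secondCountableTopology
  obtain ⟨H', _, _, hM', hd', hH', hhd', hrange', hbd'⟩ :=
    h'.isGKTrisection.exists_isHandlebody ⟨o'⟩ hne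
  haveI := hM'
  haveI := hH'.compactSpace
  haveI := hH'.connectedSpace
  haveI : T2Space H' := hhd'.isEmbedding.t2Space
  haveI : SecondCountableTopology H' := hhd'.isEmbedding.secondCountableTopology
  let b : BoundaryData (𝓡∂ 3) H (𝓡 2) := BoundaryManifold.boundaryData 2 H
  let b' : BoundaryData (𝓡∂ 3) H' (𝓡 2) := BoundaryManifold.boundaryData 2 H'
  have hinj : Injective hd := hhd.isEmbedding.injective
  have hinj' : Injective hd' := hhd'.isEmbedding.injective
  -- ### 2. the boundary diffeomorphism and its kernel condition
  have hΨaF : MapsTo Ψa (⋂ l, S l) (⋂ l, S' l) := fun p hp => by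
    rw [hΨaψ ⟨p, hp⟩]
    exact (ψ ⟨p, hp⟩).2
  have hΨaF' : MapsTo Ψa' (⋂ l, S' l) (⋂ l, S l) := fun p hp => by
    rw [hΨaψ' ⟨p, hp⟩]
    exact (ψ.symm ⟨p, hp⟩).2
  have hinv : ∀ p ∈ ⋂ l, S l, Ψa' (Ψa p) = p := fun p hp => by
    rw [hΨaψ ⟨p, hp⟩, hΨaψ' (ψ ⟨p, hp⟩), ψ.symm_apply_apply]
  have hinv' : ∀ p' ∈ ⋂ l, S' l, Ψa (Ψa' p') = p' := fun p hp => by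
    rw [hΨaψ' ⟨p, hp⟩, hΨaψ (ψ.symm ⟨p, hp⟩), ψ.apply_symm_apply]
  obtain ⟨φb, hφb, hφb'⟩ := exists_boundaryDiffeo hhd hbd b hhd' hbd' b' hFU hΨa hΨaF hFU' hΨa'
    hΨaF' hinv hinv'
  obtain ⟨z₀, hz₀⟩ := exists_incl_eq hbd b x₀.2
  have hkerb := seam_kernel_condition hhd.isEmbedding m hrange hbd b hhd'.isEmbedding hrange' hbd'
    b' ψ φb.toHomeomorph (fun x hx => by
      show hd' (b'.incl (φb x)) = _
      rw [hφb x, hΨaψ ⟨hd (b.incl x), hx⟩]) z₀ hz₀ hψ hker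
  -- ### 3. handlebody extension
  obtain ⟨Φ₀, hΦ₀⟩ := hHE g H H' hH.hasHandleDecomposition hH'.hasHandleDecomposition
    hH.isOrientable hH'.isOrientable b b' φb z₀ hkerb
  -- ### 4. the collars and the product-like normalisation
  set sc : ℝ := min rt rt' / 4 with hsc_def
  have hsc : 0 < sc := by
    have := lt_min hTS.rt_pos hTS'.rt_pos
    positivity
  have h3 : 3 * sc ≤ rt := by
    have := min_le_left rt rt'
    rw [hsc_def]; linarith
  have h3' : 3 * sc ≤ rt' := by
    have := min_le_right rt rt'
    rw [hsc_def]; linarith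
  obtain ⟨D, -, hDreg, hDhgt, hDprj, hDtoF⟩ :=
    exists_xiCollar (m := m) hT hTS hhd hrange hbd b z₀ hsc h3
  obtain ⟨D', -, hD'reg, hD'hgt, hD'prj, hD'toF⟩ :=
    exists_xiCollar (m := m) hT' hTS' hhd' hrange' hbd' b' (φb z₀) hsc h3'
  obtain ⟨Φ, ε, hε, -, hprod⟩ := hPL H H' b b' D D' φb Φ₀ hΦ₀
  have hprod' : ∀ (x' : b'.carrier) (t : ℝ), 0 ≤ t → t ≤ ε →
      Φ.symm (D'.toFun x' t) = D.toFun (φb.symm x') t := by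
    intro x' t h0 h1
    have hx := hprod (φb.symm x') t h0 h1
    rw [Diffeomorph.apply_symm_apply] at hx
    rw [← hx, Diffeomorph.symm_apply_apply]
  -- ### 6. the radius
  refine ⟨sc * min ε 1, by positivity, fun rP hrP hrPr => ?_⟩
  have hrPε : rP ≤ sc * ε := hrPr.trans (mul_le_mul_of_nonneg_left (min_le_left _ _) hsc.le)
  have hrP1 : rP ≤ sc := by nlinarith [min_le_right ε 1]
  have hrPt : rP ≤ rt := by linarith
  have hrPt' : rP ≤ rt' := by linarith
  -- ### the product formulas in the tubes
  have hPF := product_formula (m := m) hT hTS hrange D hsc hDreg hDhgt hDprj D' hD'toF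
    (Θ := Φ) (θ := φb) (Ψa := Ψa) hprod hφb hrP hrPε hrP1
  have hPF' := product_formula (m := m) hT' hTS' hrange' D' hsc hD'reg hD'hgt hD'prj D hDtoF
    (Θ := Φ.symm) (θ := φb.symm) (Ψa := Ψa') hprod' hφb' hrP hrPε hrP1
  -- ### 5. the ambient maps
  haveI : Nonempty X' := ⟨(x₀' : X')⟩
  haveI : Nonempty X := ⟨(x₀ : X)⟩
  have hbT : ∀ z ∈ (𝓡∂ 3).boundary H, hd z ∈ tubeSet Ot u v rP := fun z hz =>
    hTS.mem_tubeSet_of_mem_F hT.frame (hbd ▸ mem_image_of_mem hd hz) hrP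
  have hbT' : ∀ z ∈ (𝓡∂ 3).boundary H', hd' z ∈ tubeSet Ot' u' v' rP := fun z hz =>
    hTS'.mem_tubeSet_of_mem_F hT'.frame (hbd' ▸ mem_image_of_mem hd' hz) hrP
  obtain ⟨W, Ψs, hWo, hHW, hΨs, hΨsG⟩ := exists_seam_extension hhd (hhd'.contMDiff.comp Φ.contMDiff)
    (isOpen_tubeSet hT.frame hTS rP) hbT
    (contMDiffOn_productMap hT hTS hTS' hFU hΨa hΨaF hrP.le hrPt') (fun z hz => hPF z hz)
  obtain ⟨W', Ψs', hWo', hHW', hΨs', hΨsG'⟩ := exists_seam_extension hhd'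
    (hhd.contMDiff.comp Φ.symm.contMDiff) (isOpen_tubeSet hT'.frame hTS' rP) hbT'
    (contMDiffOn_productMap hT' hTS' hTS hFU' hΨa' hΨaF' hrP.le hrPt) (fun z hz => hPF' z hz)
  -- on the seams, `Ψs = hd' ∘ Φ ∘ hd⁻¹`, `Ψs' = hd ∘ Φ⁻¹ ∘ hd'⁻¹`
  have hS : ∀ x ∈ S (m + 1) ∩ S (m + 2), ∃ z, hd z = x := fun x hx => by
    rw [← hrange] at hx
    exact hx
  have hS' : ∀ x' ∈ S' (m + 1) ∩ S' (m + 2), ∃ z', hd' z' = x' := fun x hx => by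
    rw [← hrange'] at hx
    exact hx
  refine ⟨W, Ψs, W', Ψs', hWo, hrange ▸ hHW, hΨs, hWo', hrange' ▸ hHW', hΨs',
    ?_, ?_, ?_, ?_, ?_, ?_⟩
  · intro x hx
    obtain ⟨z, rfl⟩ := hS x hx
    rw [hΨsG z, ← hrange']
    exact mem_range_self _
  · intro x' hx'
    obtain ⟨z', rfl⟩ := hS' x' hx'
    rw [hΨsG' z', ← hrange]
    exact mem_range_self _
  · intro x hx
    obtain ⟨z, rfl⟩ := hS x hx
    rw [hΨsG z]
    show Ψs' (hd' (Φ z)) = hd z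
    rw [hΨsG' (Φ z)]
    show hd (Φ.symm (Φ z)) = hd z
    rw [Diffeomorph.symm_apply_apply]
  · intro x' hx'
    obtain ⟨z', rfl⟩ := hS' x' hx'
    rw [hΨsG' z']
    show Ψs (hd (Φ.symm z')) = hd' z'
    rw [hΨsG (Φ.symm z')]
    show hd' (Φ (Φ.symm z')) = hd' z'
    rw [Diffeomorph.apply_symm_apply]
  · intro x hx hxT
    obtain ⟨z, rfl⟩ := hS x hx
    rw [hΨsG z]
    exact hPF z hxT
  · intro x' hx' hxT'
    obtain ⟨z', rfl⟩ := hS' x' hx'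
    rw [hΨsG' z']
    exact hPF' z' hxT'

end Piece

end B2

/-! ## The registered stub -/

/-- **Registered stub `stub_seamDiffeos`** (B2 of line `lp-by-sphere-system-surgery`): the three
seam diffeomorphisms, `Ξ`-standard near the central surface, from the product-like
normalisation of collars and handlebody extension (`seam_piece` for each seam, and the least of
the three radii). -/
theorem stub_seamDiffeos : ProductLikeNormalisation → HandlebodyExtension → SeamDiffeosStmt := by
  intro hPL hHE X _ _ _ _ _ _ _ o X' _ _ _ _ _ _ _ o' g k S S' h h' x₀ x₀' ψ hψ hker u v ρ U O Ot rt
    tp u' v' ρ' U' O' Ot' rt' tp' hT hT' hTS hTS' Uψ Ψa Uψ' Ψa' _ hFU hΨa hΨaψ _ hFU' hΨa' hΨaψ'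
  have key := fun m => B2.seam_piece hPL hHE o o' h h' x₀ ψ hψ m (hker m) hT hT' hTS hTS' hFU hΨa
    hΨaψ hFU' hΨa' hΨaψ'
  choose r hr hP using key
  have hpos : 0 < min (r 0) (min (r 1) (r 2)) := lt_min (hr 0) (lt_min (hr 1) (hr 2))
  refine ⟨min (r 0) (min (r 1) (r 2)), hpos, fun m => hP m _ hpos ?_⟩
  fin_cases m
  · exact min_le_left _ _
  · exact (min_le_right _ _).trans (min_le_left _ _)
  · exact (min_le_right _ _).trans (min_le_right _ _)

end Summit.SmoothPoincare4.SmoothPoincare4.Cruxes.AgkCor6Sufficiency.LpBySphereSystemSurgery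

end
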